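import Summits.Langlands.Langlands.Theorems.MonomialConverseAbelianFreeBrauerHubs
import Summits.Langlands.Langlands.Theorems.MonomialConverseAbelianFreeBrauerAffine
import Summits.Langlands.Langlands.Theorems.MonomialConverseAbelianFreeBrauerExpansion

/-!
# Abelian-free Brauer induction: proof of the crux `MonomialConverse.AbelianFreeBrauer`

Final theorem: `abelianFreeBrauer_proof : Summit.Langlands.Langlands.Theses.MonomialConverse.AbelianFreeBrauer`
(item stmt-Langlands-18580, route-Langlands-MonomialConverse; last of the seven files
`MonomialConverseAbelianFreeBrauer{Span, Linear, Moves, Hubs, Affine, Expansion, Proof}`, which hold the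
supporting development under the same namespace) — for every finite group `G` and every
irreducible complex representation `V` of dimension `≥ 2`, the character of `V` is a `ℤ`-combination of
induced class functions `Ind_H^G φ` with `φ : H →* ℂˣ` **abelian-free** (`φ` is not the restriction of
any linear character of `G` — the item's clause verbatim).  No `sorry`, no new axioms, no `Prop`-valued
definitions (predicates are phrased as sets); everything is over the in-tree class-function library
`Literature.RepresentationTheory.FiniteGroups` (`indClassFun`, `classInner`, `virtChars`, `IsIrrChar`,
Brauer's theorem `brauer_induction_elementary_holds`, monomiality of nilpotent groups
`IsCharacter.isMonomialSum_of_isNilpotent`, Clifford's correspondence `exists_indClassFun_eq_of_inertia`).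

## The statement proved underneath (`AFB⁰`)

Let `Λ(G)` be the set of linear characters, `R(G)` the virtual characters and `J(G) = afSpan G` the
additive span of the abelian-free monomial inductions.  **`linOrth_subset_afSpan` (`AFB⁰(G)`):
`R(G) ∩ Λ(G)^⊥ ⊆ J(G)`** for every finite group `G`.  A nonlinear irreducible character is in
`R(G) ∩ Λ(G)^⊥`, whence the crux (`abelianFreeBrauer_proof`, with the dictionary `indClassFun_coe_apply`
between `indClassFun` and the explicit sum of the route statement).

## Proof of `AFB⁰(G)` (strong induction on `|G|`)

Write `π_K = Ind_K^G 1` (`indOne K`), call `K` *covering* if no nontrivial linear character is trivial on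
`K` (`coverers G`), and let `hull G K = ⋂ {ker μ : K ≤ ker μ}`.
* **Tools** (`J` is stable under induction from subgroups, inflation from quotients and twisting by
  linear characters; `J ⊥ Λ`): the *sandwich* `π_K - π_M ∈ J(G)` for `K ≤ M` with `AFB⁰(M)` and `M`
  absorbing (`indOne_sub_indOne_mem_afSpan`), the *abelian-quotient move*
  (`indClassFun_restrict_mem_afSpan`) and *quotient resolution* (`indOne_sub_one_mem_afSpan_of_quotient`).
* **Assembly** (`linOrth_subset_afSpan_of_hub`): if `H₀` covers, every admissible covering `K` has
  `π_K ≡ π_{H₀}`, every admissible non-covering `K` has `π_K ≡ e_K := π_{hull K}` with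
  `e_K (π_{H₀} - 1) ∈ J` and `linPart (e_K μ) = e_K μ`, and every virtual character is congruent to a
  `ℤ`-combination of `π_K μ` with `K` admissible (`admRem`), then `AFB⁰(G)`.
* **Expansions** (`mem_admRem_of_isNilpotent`, `mem_admRem_of_not_nilpotent`): all subgroups are
  admissible when `G` is nilpotent (monomiality); proper subgroups suffice otherwise (Brauer's theorem in
  the elementary form, the elementary subgroups being nilpotent hence proper, plus `AFB⁰` of them).
* **Hubs.** Nilpotent `G`: hub `G`, the congruences `π_K ≡ 1` through the centre
  (`indOne_sub_one_mem_of_normal_comm`).  Non-nilpotent `G` with a nontrivial commutative normal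
  subgroup `V`: hub `G` again, `indOne_sub_one_mem_of_normal_comm` dispatching on `V ⊔ K`, `V ⊓ K` and
  maximality of `K`, the residual case being the **affine branch** below.  No such `V` and `⊥` covering:
  hub `⊥` (`indOne_sub_indOne_bot_mem`).  Otherwise a linear character of prime order `p` exists
  (`exists_hom_prime_order`) and the hub is the normalizer of a Sylow `p`-subgroup (Frattini:
  `normalizer_sylow_mem_coverers`; the climb `indOne_sub_indOne_normalizer_mem` along `p`-parts).
* **Affine branch** (`indOne_sub_one_mem_afSpan_affine`): `V ⊴ G` commutative, `K` a complement, all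
  linear characters trivial on `V` ⇒ `π_K - 1 ∈ J(G)`.  `π_K - 1` is a character whose restriction to
  `V` contains each nontrivial `ψ ∈ Irr(V)` exactly once and not `1_V`; peeling off irreducible
  constituents (`mem_afSpan_of_mult`), each constituent `χ` is, by the Clifford correspondence
  (Isaacs Thm. 6.11), `Ind_{I_G(ψ)} η` with `η` linear extending some `ψ ≠ 1_V`, hence abelian-free
  (`constituent_mem_afSpan`).

References: Serre, *Linear Representations of Finite Groups* §8.5 Thm. 16, §10.5 Thm. 19
(`SerreLinearRepresentations1977`); Isaacs, *Character Theory of Finite Groups* Thm. 6.11 (`Isaacs1976`);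
R. Brauer, Ann. of Math. 48 (1947) (`Brauer1947`).
-/

set_option linter.dupNamespace false

noncomputable section

open scoped BigOperators Pointwise

namespace Summit.Langlands.Langlands.Theorems.AbelianFreeBrauer

open Literature.RepresentationTheory.FiniteGroups

variable {G : Type} [Group G]

/-! ### `AFB⁰(G)` for every finite group, by strong induction on the order -/

section Main

/-- `AFB⁰(G)`: the virtual characters orthogonal to all linear characters lie in `J(G)` — by
strong induction on `|G|`, dispatching on the hub (nilpotent: `G` with centre; a nontrivial
commutative normal subgroup: `G`; `G` perfect-like (`⊥` covers): `⊥`; otherwise the normalizer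
of a Sylow `p`-subgroup for a prime `p` dividing `|G/G'|`). [new] -/
theorem linOrth_subset_afSpan_aux : ∀ (n : ℕ) (G : Type) [Group G] [Fintype G],
    Fintype.card G = n → linOrth G ⊆ (afSpan G : Set (G → ℂ)) := by
  intro n
  induction n using Nat.strong_induction_on with
  | _ n ih => ?_
  intro G _ _ hn
  classical
  have hsub : ∀ (M : Subgroup G) [Fintype M], M ≠ ⊤ → linOrth M ⊆ (afSpan M : Set (M → ℂ)) := by
    intro M _ hM
    refine ih (Fintype.card M) ?_ M rfl
    rw [← hn]
    have h1 : Nat.card M < Nat.card G :=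
      lt_of_le_of_ne (Subgroup.card_le_card_group M)
        (fun h => hM (Subgroup.eq_top_of_card_eq M h))
    simpa only [Nat.card_eq_fintype_card] using h1
  have hquot : ∀ (N : Subgroup G) [N.Normal] [Fintype (G ⧸ N)], N ≠ ⊥ →
      linOrth (G ⧸ N) ⊆ (afSpan (G ⧸ N) : Set (G ⧸ N → ℂ)) := by
    intro N _ _ hN
    refine ih (Fintype.card (G ⧸ N)) ?_ (G ⧸ N) rfl
    rw [← hn]
    have h1 : Nat.card (G ⧸ N) < Nat.card G := by
      conv_rhs => rw [Subgroup.card_eq_card_quotient_mul_card_subgroup N]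
      exact lt_mul_of_one_lt_right Nat.card_pos ((Subgroup.one_lt_card_iff_ne_bot N).mpr hN)
    simpa only [Nat.card_eq_fintype_card] using h1
  have haff : ∀ (V K : Subgroup G) [V.Normal], (∀ x ∈ V, ∀ y ∈ V, x * y = y * x) →
      V ⊓ K = ⊥ → V ⊔ K = ⊤ → (∀ μ : G →* ℂˣ, V ≤ μ.ker) → indOne K - 1 ∈ afSpan G :=
    fun V K _ => indOne_sub_one_mem_afSpan_affine V K
  have h2 : ∀ K : Subgroup G, K ∉ coverers G → indOne K - indOne (hull G K) ∈ afSpan G :=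
    fun K hK => indOne_sub_indOne_hull_mem hsub hK
  have h4 : ∀ (K : Subgroup G) (μ : G →* ℂˣ),
      linPart G (indOne (hull G K) * fun g => (μ g : ℂ)) = indOne (hull G K) * fun g => (μ g : ℂ) :=
    fun K μ => linPart_indOne_hull_mul K μ
  by_cases hnil : Group.IsNilpotent G
  · -- hub `G`, every subgroup admissible, expansion by monomiality
    haveI := hnil
    refine linOrth_subset_afSpan_of_hub ⊤ top_mem_coverers Set.univ (fun K => indOne (hull G K))
      (fun K _ hK => ?_) (fun K _ hK => h2 K hK)
      (fun K _ hK => indOne_hull_mul_mem hsub top_mem_coverers hK) (fun K _ _ μ => h4 K μ)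
      (fun f hf => mem_admRem_of_isNilpotent hf)
    by_cases hKt : K = ⊤
    · rw [hKt, sub_self]
      exact (afSpan G).zero_mem
    · rw [indOne_top]
      obtain ⟨g, hg⟩ := not_forall.mp (fun h => hKt ((Subgroup.eq_top_iff' K).mpr h))
      haveI : Nontrivial G := nontrivial_of_ne g 1 (fun h => hg (h ▸ K.one_mem))
      exact indOne_sub_one_mem_of_normal_comm hsub hquot haff (Subgroup.center G)
        (Group.IsNilpotent.center_ne_bot G) (fun x _ y hy => Subgroup.mem_center_iff.mp hy x) hK
  · -- non-nilpotent: proper subgroups admissible, expansion by Brauer's theorem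
    have hexp : ∀ f ∈ virtChars G, ∃ (ι : Type) (_ : Fintype ι) (c : ι → ℤ) (μ : ι → (G →* ℂˣ))
        (K : ι → Subgroup G), (∀ i, K i ∈ {K : Subgroup G | K ≠ ⊤}) ∧
          f - ∑ i, (c i : ℂ) • (indOne (K i) * fun g => (μ i g : ℂ)) ∈ afSpan G :=
      fun f hf => mem_admRem_of_not_nilpotent hnil hsub hf
    by_cases hA : ∃ V : Subgroup G, V.Normal ∧ V ≠ ⊥ ∧ ∀ x ∈ V, ∀ y ∈ V, x * y = y * x
    · -- hub `G`
      obtain ⟨V, hVn, hV, hVc⟩ := hA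
      exact linOrth_subset_afSpan_of_hub ⊤ top_mem_coverers {K | K ≠ ⊤}
        (fun K => indOne (hull G K))
        (fun K _ hK => by
          rw [indOne_top]
          exact indOne_sub_one_mem_of_normal_comm hsub hquot haff V hV hVc hK)
        (fun K _ hK => h2 K hK) (fun K _ hK => indOne_hull_mul_mem hsub top_mem_coverers hK)
        (fun K _ _ μ => h4 K μ) hexp
    · have hnoab : ∀ V : Subgroup G, V.Normal → (∀ x ∈ V, ∀ y ∈ V, x * y = y * x) → V = ⊥ :=
        fun V hVn hVc => by_contra fun h => hA ⟨V, hVn, h, hVc⟩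
      by_cases hperf : (⊥ : Subgroup G) ∈ coverers G
      · -- hub `⊥`
        exact linOrth_subset_afSpan_of_hub ⊥ hperf {K | K ≠ ⊤} (fun K => indOne (hull G K))
          (fun K hKt _ => indOne_sub_indOne_bot_mem hsub hperf hKt)
          (fun K _ hK => h2 K hK) (fun K _ hK => indOne_hull_mul_mem hsub hperf hK)
          (fun K _ _ μ => h4 K μ) hexp
      · -- hub `N_G(S)`, `S` a Sylow `p`-subgroup, `p` the order of a linear character
        obtain ⟨μ, -, hμ⟩ : ∃ μ : G →* ℂˣ, (⊥ : Subgroup G) ≤ μ.ker ∧ μ ≠ 1 := by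
          rw [mem_coverers] at hperf
          push Not at hperf
          exact hperf
        obtain ⟨p, μ₀, hp, hμ₀, hμ₀p⟩ := exists_hom_prime_order hμ
        haveI : Fact p.Prime := ⟨hp⟩
        let S : Sylow p G := default
        exact linOrth_subset_afSpan_of_hub _ (normalizer_sylow_mem_coverers S) {K | K ≠ ⊤}
          (fun K => indOne (hull G K))
          (fun K hKt hK => indOne_sub_indOne_normalizer_mem hsub hnoab hμ₀ hμ₀p S hK hKt)
          (fun K _ hK => h2 K hK)
          (fun K _ hK => indOne_hull_mul_mem hsub (normalizer_sylow_mem_coverers S) hK)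
          (fun K _ _ μ => h4 K μ) hexp

/-- **`AFB⁰(G)`** for every finite group `G`: `R(G) ∩ Λ(G)^⊥ ⊆ J(G)` (not in print as far as the
item's grounders and refuters could determine; proved here). [new] -/
theorem linOrth_subset_afSpan (G : Type) [Group G] [Fintype G] :
    linOrth G ⊆ (afSpan G : Set (G → ℂ)) :=
  linOrth_subset_afSpan_aux _ G rfl

end Main

/-! ### Dictionary with the route statement -/

section Dictionary

variable [Fintype G]

open scoped Classical in
/-- The induced class function of a linear character, in the explicit form of the route statement
(`x ↦ x⁻¹` reindexing of the defining sum). [folklore] -/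
theorem indClassFun_coe_apply (H : Subgroup G) (φ : H →* ℂˣ) (g : G) :
    indClassFun H (fun h => (φ h : ℂ)) g =
      (Nat.card H : ℂ)⁻¹ *
        ∑ x : G, if h : x * g * x⁻¹ ∈ H then ((φ ⟨x * g * x⁻¹, h⟩ : ℂˣ) : ℂ) else 0 := by
  rw [indClassFun_apply]
  congr 1
  rw [← Equiv.sum_comp (Equiv.inv G)]
  refine Finset.sum_congr rfl fun x _ => ?_
  simp only [Equiv.inv_apply, inv_inv]
  by_cases h : x * g * x⁻¹ ∈ H
  · rw [dif_pos h]
    exact extend_subtypeVal_apply H _ ⟨_, h⟩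
  · rw [dif_neg h]
    exact extend_subtypeVal_of_not_mem H _ h

/-- Unwinding `J(G)`: an element of the additive closure is an explicit `ℤ`-combination of
abelian-free monomial inductions. [folklore] -/
theorem exists_data_of_mem_afSpan {f : G → ℂ} (hf : f ∈ afSpan G) :
    ∃ (ι : Type) (_ : Fintype ι) (d : ι → Σ H : Subgroup G, (H →* ℂˣ)) (m : ι → ℤ),
      (∀ i, ∀ χ : G →* ℂˣ, χ.restrict (d i).1 ≠ (d i).2) ∧
        f = ∑ i, (m i : ℂ) • indClassFun (d i).1 (fun h => ((d i).2 h : ℂ)) := by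
  classical
  refine AddSubgroup.closure_induction
    (p := fun f _ => ∃ (ι : Type) (_ : Fintype ι) (d : ι → Σ H : Subgroup G, (H →* ℂˣ))
      (m : ι → ℤ), (∀ i, ∀ χ : G →* ℂˣ, χ.restrict (d i).1 ≠ (d i).2) ∧
        f = ∑ i, (m i : ℂ) • indClassFun (d i).1 (fun h => ((d i).2 h : ℂ))) ?_ ?_ ?_ ?_ hf
  · rintro _ ⟨H, φ, hφ, rfl⟩
    exact ⟨Unit, inferInstance, fun _ => ⟨H, φ⟩, fun _ => 1, fun _ => hφ, by simp⟩
  · exact ⟨PEmpty, inferInstance, fun i => i.elim, fun i => i.elim, fun i => i.elim, by simp⟩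
  · rintro f g _ _ ⟨ι₁, _, d₁, m₁, h₁, rfl⟩ ⟨ι₂, _, d₂, m₂, h₂, rfl⟩
    refine ⟨ι₁ ⊕ ι₂, inferInstance, Sum.elim d₁ d₂, Sum.elim m₁ m₂, ?_, ?_⟩
    · rintro (i | i)
      exacts [h₁ i, h₂ i]
    · rw [Fintype.sum_sum_type]
      rfl
  · rintro f _ ⟨ι, _, d, m, h, rfl⟩
    refine ⟨ι, inferInstance, d, fun i => -m i, h, ?_⟩
    simp only [Int.cast_neg, neg_smul, Finset.sum_neg_distrib]

end Dictionary

/-- **The crux `MonomialConverse.AbelianFreeBrauer` (stmt-Langlands-18580).**  The character of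
an irreducible representation `V` of dimension `≥ 2` of a finite group `G` is a `ℤ`-combination
of `Ind_H^G φ` with `φ` a linear character of `H ≤ G` that is not the restriction of any linear
character of `G`.  Proof: `χ_V` is a nonlinear irreducible character, hence a virtual character
orthogonal to every linear character (`χ_V ∈ R(G) ∩ Λ(G)^⊥`), and `AFB⁰(G)`
(`linOrth_subset_afSpan`) puts it in `J(G)`; unwinding the additive closure gives the data.
[new] -/
theorem abelianFreeBrauer_proof :
    Summit.Langlands.Langlands.Theses.MonomialConverse.AbelianFreeBrauer := by
  intro G _ _ V hV hrank
  classical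
  haveI := hV
  have hchar : IsCharacter G V.character :=
    ⟨V, inferInstance, inferInstance, inferInstance, V.ρ, rfl⟩
  have hone : classInner V.character V.character = 1 := by
    haveI : Invertible (Nat.card G : ℂ) :=
      invertibleOfNonzero (by exact_mod_cast Nat.card_pos.ne')
    have h := FDRep.char_orthonormal V V
    rw [if_pos ⟨CategoryTheory.Iso.refl V⟩, Nat.card_eq_fintype_card] at h
    rw [classInner_apply]
    exact_mod_cast h
  have hirr : IsIrrChar G V.character := hchar.isIrrChar_of_classInner_eq_one hone
  have hne : V.character 1 ≠ 1 := by
    rw [FDRep.char_one]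
    have h2 : Module.finrank ℂ V ≠ 1 := by omega
    exact_mod_cast h2
  have hlo : V.character ∈ linOrth G := by
    refine ⟨hirr.mem_virtChars, fun χ hχ => ?_⟩
    rw [hirr.classInner_eq (mem_linF.mp hχ).1, if_neg]
    rintro rfl
    exact hne (mem_linF.mp hχ).2
  obtain ⟨ι, hι, d, m, hd, hsum⟩ := exists_data_of_mem_afSpan (linOrth_subset_afSpan G hlo)
  refine ⟨ι, hι, fun i => (d i).1, fun i => (d i).2, m, hd, fun g => ?_⟩
  rw [hsum]
  simp only [Finset.sum_apply, Pi.smul_apply, smul_eq_mul, indClassFun_coe_apply]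

end Summit.Langlands.Langlands.Theorems.AbelianFreeBrauer

end
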